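/-
Copyright: H21 K2-LIT squad (hodgecm-mathlib). Helper for crux hLiu418 = `stmt-HodgeConjecture-24832`
(route `route-HodgeConjecture-HCCMUnconditional`), G-road arch debt «(D-ht)» (LEAD ruling «M-156h», G2-PS-B).
-/
import Literature.NumberTheory.GelbartRogawski1991.DoubledUnitarySiegelPlaceComponents   -- ★ `IsSiegelM`, `detDeltaM`, `e₂`
import Mathlib.LinearAlgebra.Matrix.ConjTranspose
import HarnessLib

/-!
# The Siegel Gram determinant of a `2n × 2n` matrix — definitions

Matrix-level objects for the archimedean IWASAWA HEIGHT of the doubled unitary group along the diagonal `Δ ⊂ 𝔻 = 𝕍 ⊕ 𝕍`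
(block enumeration `Fin n ⊕ Fin n ≃ Fin (n + n)` by ★ `e₂ = finSumFinEquiv`, as in ★ `IsSiegelM`, ★ `detDeltaM`):

* `siegelD n R : Matrix (Fin (n + n)) (Fin n) R` — the matrix `[1; 1]` of the diagonal `Δ = {(x, x)}` (columns `δ_i = e_i + e_{n+i}`);
* `siegelBlockSum M := M₁₁ + M₁₂` (so ★ `detDeltaM M = (siegelBlockSum M).det`, and `IsSiegelM M ↔ M · D = D · siegelBlockSum M`);
* `siegelBlockTotal H := H₁₁ + H₁₂ + H₂₁ + H₂₂ = Dᴴ H D` — the compression of `H` to `Δ`;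
* `siegelGram T Y := det (siegelBlockTotal ((T Y)ᴴ (T Y))) = det ((T Y D)ᴴ (T Y D))` — the GRAM DETERMINANT of the `n` columns of `T Y D`
  (standard hermitian product on `ℂ^{2n}`). For `T = S⁻¹` (the majorant frame of a standard Iwasawa datum, ★ `IwasawaDatum.IsStd` (P2)) and
  `Y = x⁻¹`, `x ∈ U(n,n)`, it is left-`P_Δ`-equivariant with factor `‖det_Δ‖⁻²` and right-`C_∞`-invariant, hence computes `|det_Δ|` of the
  Iwasawa `P`-part of `x` — the theorems are in `K2LiuSiegelGramDeterminant`.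

[cite: Weil1964, Chap. I n° 8 (majorants ∕ the compact stabiliser)] [cite: KudlaRallis1994, §1 (`|a(g)|` via the Iwasawa decomposition)]
[cite: GelbartRogawski1991, §3.1 Prop. 3.1.1 p. 455 (the diagonal `Δ` and `P_Δ`)]
-/

set_option linter.dupNamespace false -- the mandated namespace repeats `HodgeConjecture.HodgeConjecture`

open scoped Matrix
open Literature.NumberTheory.GelbartRogawski1991.GRConstruction

namespace Summit.HodgeConjecture.HodgeConjecture.Cruxes.HLiu418.K2LiuSiegelGramDeterminantDefs

variable {n : ℕ}

/-- the `2n × n` matrix of the diagonal `Δ = {(x, x)} ⊂ 𝕍 ⊕ 𝕍`: rows `e₂ (inl i)` and `e₂ (inr i)` both carry the `i`-th unit row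
(`D = e₂ ∘ [1; 1]`). [cite: GelbartRogawski1991, §3.1 Prop. 3.1.1 p. 455] -/
def siegelD (n : ℕ) (R : Type*) [Zero R] [One R] : Matrix (Fin (n + n)) (Fin n) R :=
  (Matrix.fromRows (1 : Matrix (Fin n) (Fin n) R) (1 : Matrix (Fin n) (Fin n) R)).submatrix (e₂ (n := n)).symm id

/-- the block sum `M₁₁ + M₁₂` of a `2n × 2n` matrix (its determinant is ★ `detDeltaM M`; for `M ∈ P_Δ` it is the matrix of `M|_Δ`).
[cite: GelbartRogawski1991, §3.1 Prop. 3.1.1 p. 455] -/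
def siegelBlockSum {R : Type*} [Add R] (M : Matrix (Fin (n + n)) (Fin (n + n)) R) : Matrix (Fin n) (Fin n) R :=
  (Matrix.reindex (e₂ (n := n)).symm (e₂ (n := n)).symm M).toBlocks₁₁ +
    (Matrix.reindex (e₂ (n := n)).symm (e₂ (n := n)).symm M).toBlocks₁₂

/-- the total block sum `H₁₁ + H₁₂ + H₂₁ + H₂₂` of a `2n × 2n` matrix — the compression `Dᴴ H D` of `H` to the diagonal `Δ`.
[cite: GelbartRogawski1991, §3.1 Prop. 3.1.1 p. 455] -/
def siegelBlockTotal {R : Type*} [Add R] (H : Matrix (Fin (n + n)) (Fin (n + n)) R) : Matrix (Fin n) (Fin n) R :=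
  (Matrix.reindex (e₂ (n := n)).symm (e₂ (n := n)).symm H).toBlocks₁₁ +
      (Matrix.reindex (e₂ (n := n)).symm (e₂ (n := n)).symm H).toBlocks₁₂ +
    ((Matrix.reindex (e₂ (n := n)).symm (e₂ (n := n)).symm H).toBlocks₂₁ +
      (Matrix.reindex (e₂ (n := n)).symm (e₂ (n := n)).symm H).toBlocks₂₂)

/-- **the Siegel Gram determinant** `siegelGram T Y = det (Dᴴ (T Y)ᴴ (T Y) D)`: the Gram determinant, for the standard hermitian product on
`ℂ^{2n}`, of the `n` columns of `T Y D`. [cite: Weil1964, Chap. I n° 8] [cite: KudlaRallis1994, §1] -/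
noncomputable def siegelGram (T Y : Matrix (Fin (n + n)) (Fin (n + n)) ℂ) : ℂ :=
  (siegelBlockTotal ((T * Y)ᴴ * (T * Y))).det

/-- `detDeltaM M = det (siegelBlockSum M)` (definitional). [cite: GelbartRogawski1991, §3.1 Prop. 3.1.1 p. 455] -/
theorem detDeltaM_eq_det_siegelBlockSum {R : Type*} [CommRing R] (M : Matrix (Fin (n + n)) (Fin (n + n)) R) :
    detDeltaM M = (siegelBlockSum M).det := rfl

/-- `siegelGram T Y = det (siegelBlockTotal ((T Y)ᴴ (T Y)))` (definitional). [cite: KudlaRallis1994, §1] -/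
theorem siegelGram_def (T Y : Matrix (Fin (n + n)) (Fin (n + n)) ℂ) :
    siegelGram T Y = (siegelBlockTotal ((T * Y)ᴴ * (T * Y))).det := rfl

end Summit.HodgeConjecture.HodgeConjecture.Cruxes.HLiu418.K2LiuSiegelGramDeterminantDefs
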